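import Summits.AnomalousDissipation.AnomalousDissipation.Theses.MirrorEnsemble
import Summits.AnomalousDissipation.AnomalousDissipation.Theorems.MirrorVarietyTaylorGreenLoudGalerkinStatesStubTgForceRegular
import Literature.Analysis.FluidPDE.GalerkinFlow

/-!
# Sketch — crux ideas for `MirrorEnsemble.MirrorMeanBoundedFamilyTG` (= B_K, stmt-AnomalousDissipation-17694)
# ideator k = 1, round 1 (planner-cruxidea-stmt-AnomalousDissipation-17694-1-0)

Two levers, typed over existing declarations; the FIRST LEMMA of each card elaborates here, and the glue from the
transfer targets to the crux BY NAME is kernel-checked (no `sorry`).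

* Card `calm-law-selection-fix-k`: `CalmMirrorGalerkinOrbitsRealise` (first lemma, ν fixed: liminf-calm
  K-symmetric Galerkin orbits of unbounded order ⇒ ONE K-symmetric lifted Leray–Hopf path with `meanEnergy ≤ E`,
  by Krylov–Bogoliubov + Birkhoff on the K-symmetric Galerkin trajectory space) and the transfer target
  `MirrorCalmGalerkinFamilyTG` (C⁺); glue `crux_of_calm : First → C⁺ → B_K`.
* Card `viscosity-annealing-quench`: `WindowCalmToOrbitCalm` (first lemma, ν and order fixed: calm finite windows
  from FREE K-data, one per window length, ⇒ one orbit with CONVERGENT Cesàro energy ≤ E), the quench functional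
  `quenchCesaro`, the step `AnnealingStep`, the summable programme `AnnealingSummableTG` (C⁺) and the selection
  seam `QuenchWindowSelection`; glue `calmFamily_of_annealing : W → Q → C⁺ → MirrorCalmGalerkinFamilyTG`, hence
  `crux_of_annealing`.
-/

noncomputable section

set_option linter.dupNamespace false

open MeasureTheory Filter Topology Set
open scoped BigOperators
open Literature.Analysis.FunctionSpaces Literature.Analysis.FunctionSpaces.Torus
open Literature.Analysis.FluidPDE

namespace Summit.AnomalousDissipation.AnomalousDissipation.Cruxes.MirrorMeanBoundedFamilyTG.IdeatorK1

open Summit.AnomalousDissipation.AnomalousDissipation.Theorems.TaylorGreenLoudGalerkinStates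
open Summit.AnomalousDissipation.AnomalousDissipation.Theorems.TaylorGreenLoudGalerkinStates.Negative
open Summit.AnomalousDissipation.AnomalousDissipation.Theorems.TaylorGreenLoudGalerkinStates.TgForceRegular

local notation "𝕋³" => UnitAddTorus (Fin 3)
local notation "E³" => EuclideanSpace ℝ (Fin 3)

/-- The pinned Taylor–Green lambda of the route decls is `Negative.tgForce` (definitional). -/
theorem tgForce_eq :
    tgForce = (fun x : 𝕋³ => !₂[(fourier 1 (x 0) : ℂ).im * (fourier 1 (x 1) : ℂ).re * (fourier 1 (x 2) : ℂ).re,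
      -((fourier 1 (x 0) : ℂ).re * (fourier 1 (x 1) : ℂ).im * (fourier 1 (x 2) : ℂ).re), (0 : ℝ)]) :=
  rfl

/-- a.e. coordinatewise `K`-symmetry of an `H`-valued slice — verbatim the symmetry clause of the route decls
(`u_{i'}(R_i x) = ∓ u_{i'}(x)` a.e.). -/
def IsKSymmAE (v : Torus.energySpace (Fin 3)) : Prop :=
  ∀ i i' : Fin 3,
    (fun x => ((v : Lp E³ 2 (volume : Measure 𝕋³)) : 𝕋³ → E³) (Function.update x i (-x i)) i') =ᵐ[volume]
      (fun x => if i' = i then -(((v : Lp E³ 2 (volume : Measure 𝕋³)) : 𝕋³ → E³) x i')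
        else ((v : Lp E³ 2 (volume : Measure 𝕋³)) : 𝕋³ → E³) x i')

/-- Energy along the order-`N` Galerkin orbit of `a` at viscosity `ν`, steady force `f` (hub convention `∫|u|²`,
no `½`). -/
def orbitEnergy (ν : ℝ) (f : 𝕋³ → E³) (N : ℕ) (a : 𝕋³ → E³) (t : ℝ) : ℝ :=
  ∫ x, ‖Torus.galerkinFlow ν f N t a x‖ ^ 2

/-- A `K`-symmetric mean-zero Galerkin datum of order `N`. -/
def IsKDatum (N : ℕ) (a : 𝕋³ → E³) : Prop :=
  IsGalerkinMode N a ∧ HasZeroMean a ∧ IsKSymm a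

/-! ## Card 1 — calm-law selection in Fix K -/

/-- **FIRST LEMMA (card `calm-law-selection-fix-k`; ν FIXED, any `K`-field force).**  If at unboundedly many
orders `N` some `K`-symmetric mean-zero Galerkin datum has an orbit whose LIMINF running-mean energy is `≤ E`, then
there is ONE global Leray–Hopf solution of NS_ν(f) with an `H`-valued lift, `K`-symmetric a.e. for all `t ≥ 0`, whose
LIMSUP running-mean energy `meanEnergy` is `≤ E`.  Proof plan (all ingredients landed, route MomentParity): level-`N`
Krylov–Bogoliubov along the liminf-realising times ⇒ shift-invariant law on the compact trajectory space `pathSpace`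
with mean energy `≤ E` (`exists_shiftInvariant_limit`), carried by `K`-symmetric paths (closed, shift-invariant
coefficient relations `ĉ(R_i k) = R_i ĉ(k)`); Birkhoff (`exists_mem_support_birkhoff_limits`) ⇒ a support path
with CONVERGENT Cesàro energy `e ≤ E`; realisation by a global Leray–Hopf solution after a shift
(`stub_supportApprox`, `stub_realisation`), `meanEnergy u = e`; `K`-symmetry a.e. from the coefficient relations
(`ae_mirror_of_mFourierCoeff_mirror`, PumpedMirror stub C).  Size M–L, no new mathematics. -/
def CalmMirrorGalerkinOrbitsRealise : Prop :=
  ∀ (ν E : ℝ) (f : 𝕋³ → E³), 0 < ν → IsKField f →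
    (∀ N₀ : ℕ, ∃ N : ℕ, N₀ ≤ N ∧ ∃ a : 𝕋³ → E³, IsKDatum N a ∧ longTimeAvgInf (orbitEnergy ν f N a) ≤ E) →
    ∃ (u₀ : 𝕋³ → E³) (u : ℝ → 𝕋³ → E³) (U : ℝ → Torus.energySpace (Fin 3)),
      Torus.IsGlobalLerayHopf ν (fun _ => f) u₀ u ∧
      (∀ t, 0 ≤ t → ((U t : Lp E³ 2 (volume : Measure 𝕋³)) : 𝕋³ → E³) =ᵐ[volume] u t) ∧
      (∀ t, 0 ≤ t → IsKSymmAE (U t)) ∧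
      meanEnergy u ≤ E

/-- **TRANSFER TARGET C⁺ (card 1): `NS_ν(f_TG)` restricted to Fix K is NOT universally statistically fat.**
Along some `ν_j → 0` and at unboundedly many Galerkin orders, SOME `K`-symmetric mean-zero datum has an orbit with
liminf running-mean energy `≤ E` — equivalently `sup_j E_min^K(ν_j) < ∞`, `E_min^K(ν)` the minimal mean energy over
`K`-supported Galerkin-invariant laws (attained at an ergodic law).  Datum free: the `K`-attractor, a bounded UPO,
or the rest flow all qualify; the capture of the REST flow by the fat primary branch (15373 census N-5) is
irrelevant to it. -/
def MirrorCalmGalerkinFamilyTG : Prop :=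
  ∃ (E : ℝ) (ν : ℕ → ℝ), (∀ j, 0 < ν j) ∧ Tendsto ν atTop (nhds 0) ∧
    ∀ (j N₀ : ℕ), ∃ N : ℕ, N₀ ≤ N ∧ ∃ a : 𝕋³ → E³, IsKDatum N a ∧
      longTimeAvgInf (orbitEnergy (ν j) tgForce N a) ≤ E

/-- **Glue (card 1), kernel-checked: `First lemma → C⁺ → B_K` BY NAME.** -/
theorem crux_of_calm (hR : CalmMirrorGalerkinOrbitsRealise) (hC : MirrorCalmGalerkinFamilyTG) :
    Summit.AnomalousDissipation.AnomalousDissipation.Theses.MirrorEnsemble.MirrorMeanBoundedFamilyTG := by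
  intro f hf
  have hfg : f = tgForce := hf.trans tgForce_eq.symm
  subst hfg
  obtain ⟨E, ν, hν, hν0, hcalm⟩ := hC
  have key : ∀ j, ∃ (u₀ : 𝕋³ → E³) (u : ℝ → 𝕋³ → E³) (U : ℝ → Torus.energySpace (Fin 3)),
      Torus.IsGlobalLerayHopf (ν j) (fun _ => tgForce) u₀ u ∧
      (∀ t, 0 ≤ t → ((U t : Lp E³ 2 (volume : Measure 𝕋³)) : 𝕋³ → E³) =ᵐ[volume] u t) ∧
      (∀ t, 0 ≤ t → IsKSymmAE (U t)) ∧ meanEnergy u ≤ E := fun j =>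
    hR (ν j) E tgForce (hν j) stub_tgForceRegular (hcalm j)
  choose u₀ u U hLH hU hK hE using key
  exact ⟨E, ν, u₀, u, U, hν, hν0, hLH, fun j t ht => hU j t ht, fun j t ht i i' => hK j t ht i i', hE⟩

/-! ## Card 2 — viscosity annealing (the quench) -/

/-- **FIRST LEMMA (card `viscosity-annealing-quench`; ν AND the order `N` FIXED; finite-window criterion).**
If for arbitrarily long windows `[0,T]` SOME `K`-symmetric mean-zero Galerkin datum (depending on `T`) has
window-mean energy `T⁻¹∫₀ᵀ ∫|U|² ≤ E`, then ONE such datum has an orbit whose Cesàro energies CONVERGE to a limit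
`≤ E` (so both `longTimeAvgSup` and `longTimeAvgInf` are `≤ E`).  Proof plan: the empirical measures of the calm
segments are tight (Chebyshev on the mean energy, finite dimension) and every weak limit along `T_n → ∞` is invariant
for the order-`N` Galerkin flow with `∫ energy ≤ E` (lower semicontinuity), carried by the closed invariant set of
`K`-symmetric mean-zero modes; Birkhoff: the limit function `E*` has `∫E* dμ ≤ E`, so some point of the carrier has
a convergent Cesàro energy `E*(a) ≤ E`.  (Wang 2008 Thm 5 "extremal time-averaged statistics are saturated by ergodic
measures" is the same fact for the infimum.)  Size M. -/
def WindowCalmToOrbitCalm : Prop :=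
  ∀ (ν E : ℝ) (f : 𝕋³ → E³) (N : ℕ), 0 < ν → IsKField f →
    (∀ T₀ : ℝ, ∃ T : ℝ, T₀ ≤ T ∧ 0 < T ∧ ∃ a : 𝕋³ → E³, IsKDatum N a ∧ timeMean (orbitEnergy ν f N a) T ≤ E) →
    ∃ a : 𝕋³ → E³, IsKDatum N a ∧
      Tendsto (timeMean (orbitEnergy ν f N a)) atTop (nhds (longTimeAvgSup (orbitEnergy ν f N a))) ∧
      longTimeAvgSup (orbitEnergy ν f N a) ≤ E

/-- **The QUENCH functional.**  Take the calm law at viscosity `ν₁` in the form of the time averages along the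
`ν₁`-orbit of `a` (`s ↦ φ^{ν₁}_s a`), EVOLVE each of its points for time `t` at the SMALLER viscosity `ν₂`, average
over the law (inner `longTimeAvgSup` in `s`), then take the Cesàro mean in `t` (outer `longTimeAvgSup`): the
limsup-Cesàro energy of the quenched ensemble.  Its time average dominates the mean energy of an INVARIANT law of
NS_{ν₂} (Krylov–Bogoliubov), so bounding it bounds `E_min^K(ν₂)`. -/
def quenchCesaro (ν₁ ν₂ : ℝ) (N : ℕ) (a : 𝕋³ → E³) : ℝ :=
  longTimeAvgSup fun t =>
    longTimeAvgSup fun s => orbitEnergy ν₂ tgForce N (Torus.galerkinFlow ν₁ tgForce N s a) t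

/-- Calm bases at viscosity `ν`, order `N`, level `L`: `K`-data whose orbit has CONVERGENT Cesàro energy with limit `≤ L`. -/
def IsCalmBase (ν L : ℝ) (N : ℕ) (a : 𝕋³ → E³) : Prop :=
  IsKDatum N a ∧
    Tendsto (timeMean (orbitEnergy ν tgForce N a)) atTop (nhds (longTimeAvgSup (orbitEnergy ν tgForce N a))) ∧
    longTimeAvgSup (orbitEnergy ν tgForce N a) ≤ L

/-- **One annealing step `ν₁ ↘ ν₂` at order `N`, level `L`, overshoot `δ` (∃-form: the GOOD base).**  If the calm set at
level `L` is nonempty at viscosity `ν₁`, then it contains a base whose QUENCHED ensemble at `ν₂` has limsup-Cesàro energy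
`≤ L + δ`.  (The OPEN content of the card.  The ∃-form is deliberate: exotic calm bases — a Dirac law at a bounded saddle
state that the quench destabilises — may overshoot by O(1); the intended base is the turbulent calm law.  For it, at `t = 0⁺`
the ensemble energy grows at rate exactly `2ε(1 − ν₂/ν₁)` and the ensemble enstrophy at rate `2(ν₁ − ν₂)⟨‖Au‖²⟩ ≥
2(1 − ν₂/ν₁) ε²/(ν₁ L)`; `δ` is what is spent while the enstrophy re-equilibrates, and summability of `δ` along octaves is
"small scales re-equilibrate in time `O(ν^γ)`".) -/
def AnnealingStep (ν₁ ν₂ L δ : ℝ) (N : ℕ) : Prop :=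
  (∃ a : 𝕋³ → E³, IsCalmBase ν₁ L N a) →
    ∃ a : 𝕋³ → E³, IsCalmBase ν₁ L N a ∧ quenchCesaro ν₁ ν₂ N a ≤ L + δ

/-- **TRANSFER TARGET C⁺ (card 2): the SUMMABLE ANNEALING PROGRAMME along the octaves `ν₀ 2^{-j}`.**  A calm base at
`ν₀` of level `E₀` (eventually in the order `N`) and, octave by octave and eventually in `N`, annealing steps at EVERY level
below the uniform cap `E₀ + ∑' δ + 1` whose overshoots `δ j ≥ 0` are SUMMABLE. -/
def AnnealingSummableTG : Prop :=
  ∃ (E₀ ν₀ : ℝ) (δ : ℕ → ℝ), 0 < ν₀ ∧ (∀ j, 0 ≤ δ j) ∧ Summable δ ∧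
    (∃ N₀ : ℕ, ∀ N : ℕ, N₀ ≤ N → ∃ a : 𝕋³ → E³, IsCalmBase ν₀ E₀ N a) ∧
    ∀ j : ℕ, ∃ N₀ : ℕ, ∀ N : ℕ, N₀ ≤ N → ∀ L : ℝ, L ≤ E₀ + ∑' i, δ i + 1 →
      AnnealingStep (ν₀ / 2 ^ j) (ν₀ / 2 ^ (j + 1)) L (δ j) N

/-- **Selection seam of card 2 (provable now, M): a quench bound yields calm WINDOWS at the new viscosity.**  If the
quenched ensemble has limsup-Cesàro energy `≤ E₂` then for every `η > 0` and arbitrarily long `T` some point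
`φ^{ν₁}_s a` of the base orbit (a `K`-datum again: Fix K and mean zero are invariant, Galerkin modes are preserved)
has `ν₂`-window-mean energy `≤ E₂ + η` on `[0,T]` (first-moment principle in `s` after exchanging the `s`-average
with the finite `t`-window by reverse Fatou — energies along orbits issued from the `ν₂`-absorbing ball are
uniformly bounded). -/
def QuenchWindowSelection : Prop :=
  ∀ (ν₁ ν₂ E₂ η : ℝ) (N : ℕ) (a : 𝕋³ → E³), 0 < ν₂ → ν₂ ≤ ν₁ → 0 < η → IsKDatum N a →
    quenchCesaro ν₁ ν₂ N a ≤ E₂ →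
    ∀ T₀ : ℝ, ∃ T : ℝ, T₀ ≤ T ∧ 0 < T ∧ ∃ s : ℝ, 0 ≤ s ∧
      IsKDatum N (Torus.galerkinFlow ν₁ tgForce N s a) ∧
      timeMean (orbitEnergy ν₂ tgForce N (Torus.galerkinFlow ν₁ tgForce N s a)) T ≤ E₂ + η

/-- Shifted geometric partial sums: `∑_{i<j} (1/2)^{i+1} ≤ 1`. -/
theorem sum_half_pow_succ_le_one (j : ℕ) : ∑ i ∈ Finset.range j, (1 / 2 : ℝ) ^ (i + 1) ≤ 1 := by
  have h : ∑ i ∈ Finset.range j, (1 / 2 : ℝ) ^ (i + 1) = (1 / 2) * ∑ i ∈ Finset.range j, (1 / 2 : ℝ) ^ i := by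
    rw [Finset.mul_sum]
    refine Finset.sum_congr rfl fun i _ => ?_
    ring
  rw [h]
  have := sum_geometric_two_le j
  linarith

/-- **Glue (card 2), kernel-checked: the annealing programme produces the calm family C⁺ of card 1.**  Induction on
the octave `j` with levels `E₀ + S_j`, `S_j := ∑_{i<j} (δ_i + 2^{-(i+1)}) ≤ ∑' δ + 1`: calm base at `ν_j` (level `E₀ + S_j`,
eventually in `N`) ⟹ (step at that level, below the cap) a good base with quench `≤ E₀ + S_j + δ_j` ⟹ (selection seam with
`η = 2^{-(j+1)}`) calm windows at `ν_{j+1}` of level `E₀ + S_{j+1}` ⟹ (first lemma W) calm base at `ν_{j+1}`.  Then every base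
is liminf-calm at the single level `E₀ + ∑' δ + 1`. -/
theorem calmFamily_of_annealing (hW : WindowCalmToOrbitCalm) (hQ : QuenchWindowSelection)
    (hA : AnnealingSummableTG) : MirrorCalmGalerkinFamilyTG := by
  obtain ⟨E₀, ν₀, δ, hν₀, hδ0, hδs, ⟨Nb, hbase⟩, hstep⟩ := hA
  -- partial levels
  set S : ℕ → ℝ := fun j => ∑ i ∈ Finset.range j, (δ i + (1 / 2 : ℝ) ^ (i + 1)) with hS
  have hS_le : ∀ j, S j ≤ ∑' i, δ i + 1 := fun j => by
    have h1 : ∑ i ∈ Finset.range j, δ i ≤ ∑' i, δ i := hδs.sum_le_tsum (Finset.range j) fun i _ => hδ0 i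
    have h2 := sum_half_pow_succ_le_one j
    simp only [hS, Finset.sum_add_distrib]
    linarith
  have hS_succ : ∀ j, S (j + 1) = S j + (δ j + (1 / 2 : ℝ) ^ (j + 1)) := fun j => by
    simp only [hS, Finset.sum_range_succ]
  have hS0 : S 0 = 0 := by simp [hS]
  -- viscosities
  set ν : ℕ → ℝ := fun j => ν₀ / 2 ^ j with hν
  have hνpos : ∀ j, 0 < ν j := fun j => by simp only [hν]; positivity
  have hνle : ∀ j, ν (j + 1) ≤ ν j := fun j => by
    simp only [hν]
    apply div_le_div_of_nonneg_left hν₀.le (by positivity)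
    exact pow_le_pow_right₀ (by norm_num) (Nat.le_succ j)
  have hν0 : Tendsto ν atTop (nhds 0) := by
    have h2 : Tendsto (fun j : ℕ => ((2 : ℝ) ^ j)⁻¹) atTop (nhds 0) :=
      tendsto_inv_atTop_zero.comp (tendsto_pow_atTop_atTop_of_one_lt (by norm_num : (1 : ℝ) < 2))
    have : Tendsto (fun j : ℕ => ν₀ * ((2 : ℝ) ^ j)⁻¹) atTop (nhds (ν₀ * 0)) := h2.const_mul ν₀
    simpa [hν, div_eq_mul_inv] using this
  have hTG : IsKField tgForce := stub_tgForceRegular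
  -- the inductive claim: eventually in N, a calm base at ν_j of level E₀ + S j
  have claim : ∀ j, ∃ N₀ : ℕ, ∀ N : ℕ, N₀ ≤ N → ∃ a : 𝕋³ → E³, IsCalmBase (ν j) (E₀ + S j) N a := by
    intro j
    induction j with
    | zero =>
      refine ⟨Nb, fun N hN => ?_⟩
      obtain ⟨a, ha⟩ := hbase N hN
      have hν0' : ν 0 = ν₀ := by simp [hν]
      refine ⟨a, ?_⟩
      rw [hν0', hS0, add_zero]
      exact ha
    | succ j ih =>
      obtain ⟨N₁, hN₁⟩ := ih
      obtain ⟨N₂, hN₂⟩ := hstep j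
      refine ⟨max N₁ N₂, fun N hN => ?_⟩
      have hne : ∃ a : 𝕋³ → E³, IsCalmBase (ν j) (E₀ + S j) N a := hN₁ N (le_of_max_le_left hN)
      have hcap : E₀ + S j ≤ E₀ + ∑' i, δ i + 1 := by linarith [hS_le j]
      -- the step at level E₀ + S j (its viscosities are literally ν j and ν (j+1))
      obtain ⟨a, ⟨ha, hconv, hle⟩, hq⟩ := hN₂ N (le_of_max_le_right hN) (E₀ + S j) hcap hne
      -- selection seam with η = (1/2)^(j+1)
      have hη : (0 : ℝ) < (1 / 2 : ℝ) ^ (j + 1) := by positivity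
      have hwin := hQ (ν j) (ν (j + 1)) (E₀ + S j + δ j) ((1 / 2 : ℝ) ^ (j + 1)) N a (hνpos (j + 1)) (hνle j) hη
        ha hq
      -- calm windows at ν (j+1), level E₀ + S (j+1)
      have hwin' : ∀ T₀ : ℝ, ∃ T : ℝ, T₀ ≤ T ∧ 0 < T ∧ ∃ b : 𝕋³ → E³, IsKDatum N b ∧
          timeMean (orbitEnergy (ν (j + 1)) tgForce N b) T ≤ E₀ + S (j + 1) := by
        intro T₀
        obtain ⟨T, hT₀, hT, s, -, hsd, hsm⟩ := hwin T₀
        refine ⟨T, hT₀, hT, _, hsd, ?_⟩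
        rw [hS_succ]; linarith
      obtain ⟨b, hb, hbconv, hble⟩ := hW (ν (j + 1)) (E₀ + S (j + 1)) tgForce N (hνpos (j + 1)) hTG hwin'
      exact ⟨b, hb, hbconv, hble⟩
  -- assemble C⁺ at the single level E₀ + ∑' δ + 1
  refine ⟨E₀ + ∑' i, δ i + 1, ν, hνpos, hν0, fun j N₀ => ?_⟩
  obtain ⟨N₁, hN₁⟩ := claim j
  obtain ⟨a, ha, hconv, hle⟩ := hN₁ (max N₀ N₁) (le_max_right _ _)
  refine ⟨max N₀ N₁, le_max_left _ _, a, ha, ?_⟩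
  have hinf : longTimeAvgInf (orbitEnergy (ν j) tgForce (max N₀ N₁) a) =
      longTimeAvgSup (orbitEnergy (ν j) tgForce (max N₀ N₁) a) := by
    unfold longTimeAvgInf
    exact hconv.liminf_eq
  rw [hinf]
  linarith [hS_le j]

/-- **`W → Q → AnnealingSummableTG → B_K` BY NAME** (through card 1's realisation). -/
theorem crux_of_annealing (hR : CalmMirrorGalerkinOrbitsRealise) (hW : WindowCalmToOrbitCalm)
    (hQ : QuenchWindowSelection) (hA : AnnealingSummableTG) :
    Summit.AnomalousDissipation.AnomalousDissipation.Theses.MirrorEnsemble.MirrorMeanBoundedFamilyTG :=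
  crux_of_calm hR (calmFamily_of_annealing hW hQ hA)

end Summit.AnomalousDissipation.AnomalousDissipation.Cruxes.MirrorMeanBoundedFamilyTG.IdeatorK1

end
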